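import Summits.ResolutionOfSingularities.ResolutionOfSingularities.Theorems.MarkedTransferCampaignW46MohWindowShadeFormalStep
import Summits.ResolutionOfSingularities.ResolutionOfSingularities.Theorems.MarkedTransferCampaignW46MohWindowShadeFormalStatement
import Summits.ResolutionOfSingularities.ResolutionOfSingularities.Theorems.MarkedTransferCampaignW46MohWindowShadePolyPersistence
import Summits.ResolutionOfSingularities.ResolutionOfSingularities.Theorems.WildConesCampaignW46RationalPoint
import HarnessLib

/-!
# [OURS · L1 W4.6 rung (iii)] PERSISTENCE of the formally-polynomial purely inseparable window: over an algebraically closed field the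
# regime `Regime.mohWindowSurfaceFormalPoly` PROPAGATES along permissible blow-ups inside o1's regime of record

Cell `res-hironaka`, LADDER-RESOLUTION rung L (D-0089), slot W4.6 rung (iii); seat res-L1-s46-pv-6 (gen 5). Host route MarkedTransfer,
`--supports stmt-ResolutionOfSingularities-16155 --as helper`; kind proof (no definition). Sibling of gen 4's `…MohWindowShadePolyPersistence.lean`
(p523986) for the formal regime typed in `…MohWindowShadeFormalStatement.lean`.

WHAT. `mohWindowSurfaceFormalPoly_transform` — `K` algebraically closed; if `(Z, E)` lies in `Regime.mohWindowSurfaceFormalPoly`, `π : Z′ → Z` is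
the blow-up at a permissible centre and the transform lies in o1's `regimeMohWindowSurfaceInsep`, then the transform lies in
`Regime.mohWindowSurfaceFormalPoly`: over the centre the formal anchor takes the model step (brick 2c `exists_formalAnchor_step`; the new polynomial
is cleaned and its window is strict by brick 1 `window_strict_of_formalAnchor`), off the centre it is carried verbatim (`exists_formalAnchor_offCentre`).
Consequence `permissibleRun_mohWindowSurfaceFormalPoly_of_start`: a run inside the regime of record whose stage `0` is formally-polynomial stays
formally-polynomial — the every-stage conjunct of the regime is no extra constraint on runs (answer to the lanes' standard «is the sub-regime
persistent» question, as for #215).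

HONEST FRAMING. Nothing here is a statement of H. Hironaka's manuscript [Hironaka2017] (Def. 2.1 p.5, Th. 16.6 p.84 — scope only, under
adjudication) and nothing asserts that any statement of it holds. AI-written; AI review is weaker than expert review. No `sorry`; axioms
standard. [folklore]
-/

noncomputable section

set_option linter.dupNamespace false -- mandated namespace of this single-conjunct summit

open CategoryTheory AlgebraicGeometry TopologicalSpace IsLocalRing MvPolynomial

namespace Summit.ResolutionOfSingularities.ResolutionOfSingularities.Theorems

namespace CampaignW46

namespace MohWindowShadeFormalPersistence

open CategoryTheory AlgebraicGeometry TopologicalSpace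
open Literature.AlgebraicGeometry.Resolution
open Literature.AlgebraicGeometry.Resolution.PointBlowup
open Literature.AlgebraicGeometry.Resolution.Hauser2010
open Literature.AlgebraicGeometry.Hironaka2017.S02Preliminaries
open Literature.AlgebraicGeometry.Hironaka2017.Datum
open Scheme.IdealSheafData
open MohWindowShadeFormalAnchor (window_of_formalAnchor window_strict_of_formalAnchor)
open MohWindowShadeFormalStep (exists_formalAnchor_step exists_formalAnchor_offCentre)

variable {p : ℕ} [Fact p.Prime] {K : Type} [Field K] [CharP K p]

/-- **PERSISTENCE.** [OURS · L1 W4.6 rung (iii)] NOT a statement of the manuscript. Over an algebraically closed field: if `(Z, E)` lies in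
`Regime.mohWindowSurfaceFormalPoly`, `π : Z′ → Z` is a blow-up of the ambient datum at a permissible centre and the transform lies in o1's regime
`regimeMohWindowSurfaceInsep`, then the transform lies in `Regime.mohWindowSurfaceFormalPoly`. [cite: Hauser2010, §F (chart expressions of a point blowup)]
[cite: StacksProject, Tag 0CY7] -/
theorem mohWindowSurfaceFormalPoly_transform [IsAlgClosed K] {A A' : AmbientDatum p K} {E : IdealExponent A.Z} {D : Closeds A.Z}
    (π : A'.Z ⟶ A.Z) (hπ : IsBlowup π (vanishingIdeal D)) (hhom : A'.hom = π ≫ A.hom) (hD : E.IsPermissibleCentre A.hom D)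
    (hRg : Regime.mohWindowSurfaceFormalPoly (p := p) (K := K) A E)
    (hRg' : regimeMohWindowSurfaceInsep (p := p) (K := K) A' (E.transform π D)) :
    Regime.mohWindowSurfaceFormalPoly (p := p) (K := K) A' (E.transform π D) := by
  classical
  haveI : IsLocallyNoetherian A'.Z := ambient_isLocallyNoetherian A'
  refine ⟨hRg', fun ξ' hξ' => ?_⟩
  obtain ⟨hRgI, hformal⟩ := hRg
  obtain ⟨ξ₀, hξ₀S, hξ₀cl, hDξ₀⟩ :=
    IsPermissibleCentre.exists_eq_singleton_of_isolatedSing hD ((regimeMohWindowSurfaceInsep_iff _ _).mp hRgI).1.1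
  obtain ⟨hR', h3', hcl', -, hb'⟩ := MohWindowShadeAnchorWalk.regime_point hRg' hξ'
  haveI := hR'
  have hb : E.b = p := ((regimeMohWindowSurfaceInsep_iff _ _).mp hRgI).2
  -- the anchor downstairs, at `π ξ'` (a singular point of `E`)
  have hmem : π.base ξ' ∈ E.sing := sing_subset_of_transform hπ E hD.subset_sing hξ'
  obtain ⟨hR, h3, -, -, -⟩ := MohWindowShadeAnchorWalk.regime_point hRgI hmem
  haveI := hR
  obtain ⟨e, f₀, w, F, hclean, hpF, -, hJ, hw, hE⟩ := hformal (π.base ξ') hmem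
  -- conclusion template: a cleaned formal anchor at a singular point of the regime is a formally-polynomial presentation
  have conclude : ∀ (F' : MvPolynomial (Fin 2) K)
      (e' : AdicCompletion (maximalIdeal (A'.Z.presheaf.stalk ξ')) (A'.Z.presheaf.stalk ξ') ≃+* MvPowerSeries (Option (Fin 2)) K)
      (f' : A'.Z.presheaf.stalk ξ') (w' : MvPowerSeries (Option (Fin 2)) K),
      deletePthPowers p F' = F' → stalkIdeal (E.transform π D).J ξ' = Ideal.span {f'} → IsUnit w' →
      e' (algebraMap _ _ f') = w' * (MvPowerSeries.X none ^ p + eval₂ MvPowerSeries.C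
        (fun l : Fin 2 => if l = (0 : Fin 2) then MvPowerSeries.X (some (0 : Fin 2)) else MvPowerSeries.X (some 1)) F') →
      MohWindowSurfaceFormalPolyAt p K (A'.Z.presheaf.stalk ξ') (stalkIdeal (E.transform π D).J ξ') := by
    intro F' e' f' w' hclean' hJ' hw' hE'
    have hws := window_strict_of_formalAnchor hRg' hξ' e' hJ' hw' hclean' hE'
    exact ⟨e', f', w', F', hclean', hws.1, hws.2, hJ', hw', hE'⟩
  by_cases hover : π.base ξ' = ξ₀
  · -- over the centre: the model takes a step (the point upstairs is rational over the centre)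
    have hDπ : (D : Set A.Z) = {π.base ξ'} := by rw [hDξ₀, hover]
    have hdeg : ∀ d ∈ F.support, p ≤ d.degree := fun d hd =>
      (Literature.Barriers.ResolutionOfSingularities.HauserPerlega.natCast_le_ordZero_iff F p).mp hpF.le d hd
    haveI : LocallyOfFiniteType (π ≫ A.hom) := by
      rw [← hhom]
      haveI := A'.smooth
      infer_instance
    have hrat : ∀ y : A'.Z.presheaf.stalk ξ', ∃ r : A.Z.presheaf.stalk (π.base ξ'),
        y - (π.stalkMap ξ').hom r ∈ maximalIdeal (A'.Z.presheaf.stalk ξ') := fun y =>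
      CampaignW46.ChartPoint.exists_sub_stalkMap_mem_maximalIdeal_of_isClosed π A.hom ξ' hcl' y
    obtain ⟨c, b, e', f', w', -, -, -, hJ', hw', hE'⟩ :=
      exists_formalAnchor_step π D hπ hb hDπ hmem hξ' h3 hrat e hJ hw ⟨F, 0⟩ hdeg hE
    exact conclude _ e' f' w' (MohWindowShadePolyPersistence.deletePthPowers_step_F c b ⟨F, 0⟩) hJ' hw' hE'
  · -- off the centre: transport
    have hoff : π.base ξ' ∉ (D : Set A.Z) := by rw [hDξ₀, Set.mem_singleton_iff]; exact hover
    obtain ⟨e', f', hJ', hE'⟩ := exists_formalAnchor_offCentre (E := E) π hπ hoff e hJ _ hE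
    exact conclude F e' f' w hclean hJ' hw hE'

/-- **A run inside o1's regime of record whose initial stage is formally-polynomial stays formally-polynomial** (algebraically closed field).
[OURS · L1 W4.6 rung (iii)] NOT a statement of the manuscript. [folklore] -/
theorem permissibleRun_mohWindowSurfaceFormalPoly_of_start [IsAlgClosed K] (r : PermissibleRun p K)
    (hr : ∀ k, regimeMohWindowSurfaceInsep (p := p) (K := K) (r.A k) (r.E k))
    (h0 : Regime.mohWindowSurfaceFormalPoly (p := p) (K := K) (r.A 0) (r.E 0)) (k : ℕ) :
    Regime.mohWindowSurfaceFormalPoly (p := p) (K := K) (r.A k) (r.E k) := by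
  induction k with
  | zero => exact h0
  | succ k ih =>
    have h := mohWindowSurfaceFormalPoly_transform (r.π k) (r.blowup k) (r.hom_eq k) (r.permissible k) ih
      (by rw [← r.E_succ k]; exact hr (k + 1))
    rw [r.E_succ k]
    exact h

end MohWindowShadeFormalPersistence

end CampaignW46

end Summit.ResolutionOfSingularities.ResolutionOfSingularities.Theorems

end
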